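import Summits.BirchSwinnertonDyer.Rank1Residual.Additive.RamifiedSevenGenusUnitSideUpToUnit
import Summits.BirchSwinnertonDyer.Rank1Residual.Additive.RamifiedSevenResidueIsGenusUnitClassOfIntegralComparison
import HarnessLib

set_option autoImplicit false

/-!
# `𝒞₇` genus road: stub 2★ `stub_primitiveAdmissibleMemberSeven` (type VERBATIM) with K1ᵘ in the RESIDUE form and in the
# UNIT form (repair R1ᵘ after the (S5) verdict) — the composition a v14 `kato_perrin_riou_zp` skeleton closes by `exact`

Cell bsd-cm, seat bsd-cm-k-ty1 g25 (SUMMON 16c4e918e43e0aee, row GENUS-PORT-A3), companion of `RamifiedSevenGenusUnitSideUpToUnit.lean`.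
Row B's (β) `primitiveAdmissibleMemberSeven_of_genus` (p77xxxx, `RamifiedSevenPrimitiveAdmissibleMember.lean`) and the K2ᶜ row's
`primitiveAdmissibleMemberSeven_of_integralComparison` (p782137's companion, `RamifiedSevenResidueIsGenusUnitClassOfIntegralComparison.lean`)
take K1ᵘ in row A's ORIENTED EXACT-constant form `hK1u : ∀ F θu, pin → ∃ d, OrientedGenusFactorisationShape d`, a letter the
critic's orbit witness (idea-crit-15 g14, `not_stub_K1u`) makes uninhabitable modulo `Nonempty` + non-degeneracy.  Conjunct (ii) of 2★
consumes K1ᵘ ONLY through the genus residue (block (B3)'s `residualNonvanishingSeven_of_genus (hRes)`, in the tree); this file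
re-keys the two assemblies on `hRes` (§1) and hence on the UNIT-form K1ᵘ letter (§2, via `exists_genusResidueNonzero_of_unitK1u`).
Proof of §1 = (β)'s proof with `residualNonvanishingSeven_of_genus hRes` in place of `…_of_orientedGenus`; nothing else changes.

A v14 composition then reads (K1ᵘ stub re-lettered with conjunct (5) := `UnitSideIdentityShapeUpToUnit F θu`, derived letter
`genusUnitFactorisationSeven_of := GenusSeven.genusUnitFactorisationSeven_of_inputs stub_…`):
`exact GenusSeven.primitiveAdmissibleMemberSeven_of_integralComparison_upToUnit fact_star hGZK fact_tsuji fact_fwKL fact_fwSt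
genusUnitFactorisationSeven_of integralComparisonSeven_of stub_muFreeRealisedFamilySeven`.

Theorems only; NO named fact; kit 0.  HONEST LABEL: CONDITIONAL on ★, GZK, the three printed facts of (G6), a K1ᵘ letter, the
K2ᶜ letter and (E2); nothing closes; stmt-BirchSwinnertonDyer-19945 is OPEN; `X12.CMRamifiedSeven` is NOT proved; BSD is claimed
for no curve.

## References
K. Kato, Astérisque 295 (2004) Thm. 12.5 (1)(4) (pp. 221–222), Conj. 12.10 (p. 224), (15.16.1) (p. 265) [Kato2004Asterisque];
T. Tsuji, J. Number Theory 78 (1999) Thm 3.1 (i) (p. 6) [Tsuji1999]; B. Ferrero, L. Washington, Ann. of Math. 109 (1979)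
[FerreroWashington1979]; S. Lang (1990) Ch. 10 §2 Thm 2.3 [Lang1990].
-/

noncomputable section

open scoped Classical NumberField
open WeierstrassCurve Literature.NumberTheory.EllipticCurves
open Literature.NumberTheory.EllipticCurves.Rank1Residual
open Literature.NumberTheory.EllipticCurves.IwasawaAlgebra
open Literature.NumberTheory.EllipticCurves.Kato2004
open Literature.NumberTheory.ComplexMultiplication.EllipticUnits
open Summit.BirchSwinnertonDyer.Rank1Residual
open Summit.BirchSwinnertonDyer.Rank1Residual.Additive

namespace Summit.BirchSwinnertonDyer.Rank1Residual.Additive.GenusSeven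

/-! ## §1 2★ with K1ᵘ in the RESIDUE form `hRes` -/

/-- **STUB 2★ (type VERBATIM) from the genus inputs with K1ᵘ in the RESIDUE form** `hRes` («every value-pinned genus frame carries a
datum with non-zero genus residue», the `hRes` binder of block (B3)), K2ᶜ (`hK2c`) and (E2): (β)'s proof with conjunct (ii) by
`residualNonvanishingSeven_of_genus hRes hK2c`.  CONDITIONAL; nothing asserted; 19945 OPEN.
[cite: Kato2004Asterisque, Thm. 12.5 (1)(4) (pp. 221–222), Conj. 12.10 (p. 224), (15.16.1) (p. 265)] [cite: Tsuji1999, Thm 3.1 (i) (p. 6)] -/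
theorem primitiveAdmissibleMemberSeven_of_residue (hstar : exists_zetaClassPosition_of_rank_le_one)
    (hGZK : rank_eq_analyticRank_of_analyticRank_le_one)
    (hRes : ∀ (F : GenusFrame) (θu : ∀ n : ℕ, globalUnitsOf (F.layer n)), IsNormedEllipticUnitFamily F θu →
      ∃ d : GenusDatum F θu, GenusResidueNonzeroShape d)
    (hK2c : ∀ (W : WeierstrassCurve ℚ) [W.IsElliptic] [W.IsGloballyMinimal] [Fact (Nat.Prime 7)], X12.ClassCSeven W →
      letI : ContinuousSMul ℤ_[7] (W.tateModule 7) := TateModule.continuousSMul_padicInt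
      ∀ (K : ZpExtension ℚ 7) (hK : K.IsCyclotomic) (γ : Field.absoluteGaloisGroup ℚ) (_ : K.IsTopGenerator γ)
        (I : IwasawaH1Data W 7 K γ),
        ∃ (F : GenusFrame) (θu : ∀ n : ℕ, globalUnitsOf (F.layer n)), IsNormedEllipticUnitFamily F θu ∧
          ∀ d : GenusDatum F θu, ∃ Φ : KatoGenusFrame W K hK I d, ResidueIsGenusUnitClassShape Φ)
    (hE2 : ∀ (W : WeierstrassCurve ℚ) [W.IsElliptic] [W.IsGloballyMinimal] [Fact (Nat.Prime 7)], X12.ClassCSeven W →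
      ∃ (W' : WeierstrassCurve ℚ) (_ : W'.IsElliptic) (_ : W'.IsGloballyMinimal), IsIsogenous W W' ∧
        letI : ContinuousSMul ℤ_[7] (W'.tateModule 7) := TateModule.continuousSMul_padicInt
        ∀ (K : ZpExtension ℚ 7) (hK : K.IsCyclotomic) (γ : Field.absoluteGaloisGroup ℚ) (_ : K.IsTopGenerator γ)
          (I : IwasawaH1Data W' 7 K γ), Kato2004.HasMuFreeRealisedZetaFamily W' 7 K hK I) :
    ∀ (W : WeierstrassCurve ℚ) [W.IsElliptic] [W.IsGloballyMinimal] [Fact (Nat.Prime 7)], X12.ClassCSeven W →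
      ∃ (W' : WeierstrassCurve ℚ) (_ : W'.IsElliptic) (_ : W'.IsGloballyMinimal), IsIsogenous W W' ∧
        letI : ContinuousSMul ℤ_[7] (W'.tateModule 7) := TateModule.continuousSMul_padicInt
        (∃ (K : ZpExtension ℚ 7) (hK : K.IsCyclotomic) (γ : Field.absoluteGaloisGroup ℚ) (_ : K.IsTopGenerator γ)
          (I : IwasawaH1Data W' 7 K γ) (z₀ : I.H), Kato2004.IsAdmissibleZetaClass W' 7 K hK I z₀) ∧
        (∀ (K : ZpExtension ℚ 7) (hK : K.IsCyclotomic) (γ : Field.absoluteGaloisGroup ℚ) (_ : K.IsTopGenerator γ)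
          (I : IwasawaH1Data W' 7 K γ) (z₀ : I.H), Kato2004.IsAdmissibleZetaClass W' 7 K hK I z₀ →
          z₀ ∉ (IwasawaAlgebra.augIdealP 7 • (⊤ : Submodule (IwasawaAlgebra 7) I.H))) := by
  intro W _ _ _ hC
  obtain ⟨W', hE', hM', hiso, hfam⟩ := hE2 W hC
  haveI := hE'
  haveI := hM'
  have hC' : X12.ClassCSeven W' := hC.of_isIsogenous hiso
  refine ⟨W', hE', hM', hiso, ?_, residualNonvanishingSeven_of_genus hRes hK2c W' hC'⟩
  haveI : ContinuousSMul ℤ_[7] (W'.tateModule 7) := TateModule.continuousSMul_padicInt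
  have hK : (CyclotomicZp.zpExtension 7).IsCyclotomic := CyclotomicZp.isCyclotomic_zpExtension 7
  obtain ⟨γ, hγ, -⟩ := CyclotomicZp.exists_isTopGenerator_zpExtension 7
  obtain ⟨I⟩ := nonempty_iwasawaH1Data_holds W' 7 (CyclotomicZp.zpExtension 7) γ hK hγ
  obtain ⟨z₀, hz₀⟩ :=
    exists_isAdmissibleZetaClass_of_classCSeven hstar hGZK W' hC' hK hγ I (hfam _ hK γ hγ I)
  exact ⟨CyclotomicZp.zpExtension 7, hK, γ, hγ, I, z₀, hz₀⟩

/-! ## §2 2★ with K1ᵘ in the UNIT form -/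

/-- **STUB 2★ (type VERBATIM) from the genus inputs with K1ᵘ in the UNIT form** `hK1u : ∀ F θu, pin → ∃ d, d.UnitFactorisationShape`
(§1 at `hRes := exists_genusResidueNonzero_of_unitK1u h₄ h₂ h₂' hK1u`).  CONDITIONAL; nothing asserted; 19945 OPEN.
[cite: Kato2004Asterisque, Thm. 12.5 (1)(4) (pp. 221–222), (15.16.1) (p. 265)] [cite: Tsuji1999, Thm 3.1 (i) (p. 6)] [cite: FerreroWashington1979, main theorem] -/
theorem primitiveAdmissibleMemberSeven_of_unitGenus (hstar : exists_zetaClassPosition_of_rank_le_one)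
    (hGZK : rank_eq_analyticRank_of_analyticRank_le_one)
    (h₄ : Literature.NumberTheory.IwasawaTheory.tsuji1999_thm31_colemanMap)
    (h₂ : Literature.NumberTheory.IwasawaTheory.ferreroWashington_kubotaLeopoldtSeries_unitCoeff)
    (h₂' : Literature.NumberTheory.IwasawaTheory.ferreroWashington_stickelbergerSeries_unitCoeff)
    (hK1u : ∀ (F : GenusFrame) (θu : ∀ n : ℕ, globalUnitsOf (F.layer n)), IsNormedEllipticUnitFamily F θu →
      ∃ d : OrientedGenusDatum F θu, d.UnitFactorisationShape)
    (hK2c : ∀ (W : WeierstrassCurve ℚ) [W.IsElliptic] [W.IsGloballyMinimal] [Fact (Nat.Prime 7)], X12.ClassCSeven W →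
      letI : ContinuousSMul ℤ_[7] (W.tateModule 7) := TateModule.continuousSMul_padicInt
      ∀ (K : ZpExtension ℚ 7) (hK : K.IsCyclotomic) (γ : Field.absoluteGaloisGroup ℚ) (_ : K.IsTopGenerator γ)
        (I : IwasawaH1Data W 7 K γ),
        ∃ (F : GenusFrame) (θu : ∀ n : ℕ, globalUnitsOf (F.layer n)), IsNormedEllipticUnitFamily F θu ∧
          ∀ d : GenusDatum F θu, ∃ Φ : KatoGenusFrame W K hK I d, ResidueIsGenusUnitClassShape Φ)
    (hE2 : ∀ (W : WeierstrassCurve ℚ) [W.IsElliptic] [W.IsGloballyMinimal] [Fact (Nat.Prime 7)], X12.ClassCSeven W →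
      ∃ (W' : WeierstrassCurve ℚ) (_ : W'.IsElliptic) (_ : W'.IsGloballyMinimal), IsIsogenous W W' ∧
        letI : ContinuousSMul ℤ_[7] (W'.tateModule 7) := TateModule.continuousSMul_padicInt
        ∀ (K : ZpExtension ℚ 7) (hK : K.IsCyclotomic) (γ : Field.absoluteGaloisGroup ℚ) (_ : K.IsTopGenerator γ)
          (I : IwasawaH1Data W' 7 K γ), Kato2004.HasMuFreeRealisedZetaFamily W' 7 K hK I) :
    ∀ (W : WeierstrassCurve ℚ) [W.IsElliptic] [W.IsGloballyMinimal] [Fact (Nat.Prime 7)], X12.ClassCSeven W →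
      ∃ (W' : WeierstrassCurve ℚ) (_ : W'.IsElliptic) (_ : W'.IsGloballyMinimal), IsIsogenous W W' ∧
        letI : ContinuousSMul ℤ_[7] (W'.tateModule 7) := TateModule.continuousSMul_padicInt
        (∃ (K : ZpExtension ℚ 7) (hK : K.IsCyclotomic) (γ : Field.absoluteGaloisGroup ℚ) (_ : K.IsTopGenerator γ)
          (I : IwasawaH1Data W' 7 K γ) (z₀ : I.H), Kato2004.IsAdmissibleZetaClass W' 7 K hK I z₀) ∧
        (∀ (K : ZpExtension ℚ 7) (hK : K.IsCyclotomic) (γ : Field.absoluteGaloisGroup ℚ) (_ : K.IsTopGenerator γ)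
          (I : IwasawaH1Data W' 7 K γ) (z₀ : I.H), Kato2004.IsAdmissibleZetaClass W' 7 K hK I z₀ →
          z₀ ∉ (IwasawaAlgebra.augIdealP 7 • (⊤ : Submodule (IwasawaAlgebra 7) I.H))) :=
  primitiveAdmissibleMemberSeven_of_residue hstar hGZK (exists_genusResidueNonzero_of_unitK1u h₄ h₂ h₂' hK1u) hK2c hE2

/-- **STUB 2★ (type VERBATIM) from the genus inputs with K1ᵘ in the UNIT form and K2ᶜ in its PINNED INTEGRAL-COMPARISON form**
(`hIC` = the v13 derived letter `integralComparisonSeven_of`) — the term a v14 composition closes by `exact`.  CONDITIONAL; nothing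
asserted; 19945 OPEN. [cite: Kato2004Asterisque, Thm. 12.5 (1)(4) (pp. 221–222), 15.14 (p. 264), (15.16.1) (p. 265)] [cite: Tsuji1999, Thm 3.1 (i) (p. 6)] -/
theorem primitiveAdmissibleMemberSeven_of_integralComparison_upToUnit (hstar : exists_zetaClassPosition_of_rank_le_one)
    (hGZK : rank_eq_analyticRank_of_analyticRank_le_one)
    (h₄ : Literature.NumberTheory.IwasawaTheory.tsuji1999_thm31_colemanMap)
    (h₂ : Literature.NumberTheory.IwasawaTheory.ferreroWashington_kubotaLeopoldtSeries_unitCoeff)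
    (h₂' : Literature.NumberTheory.IwasawaTheory.ferreroWashington_stickelbergerSeries_unitCoeff)
    (hK1u : ∀ (F : GenusFrame) (θu : ∀ n : ℕ, globalUnitsOf (F.layer n)), IsNormedEllipticUnitFamily F θu →
      ∃ d : OrientedGenusDatum F θu, d.UnitFactorisationShape)
    (hIC : exists_zetaClassPosition_of_rank_le_one → rank_eq_analyticRank_of_analyticRank_le_one →
      ∀ (W : WeierstrassCurve ℚ) [W.IsElliptic] [W.IsGloballyMinimal] [Fact (Nat.Prime 7)], X12.ClassCSeven W →
      letI : ContinuousSMul ℤ_[7] (W.tateModule 7) := TateModule.continuousSMul_padicInt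
      ∀ (K : ZpExtension ℚ 7) (hK : K.IsCyclotomic) (γ : Field.absoluteGaloisGroup ℚ) (_ : K.IsTopGenerator γ)
        (I : IwasawaH1Data W 7 K γ),
        ∃ (F : GenusFrame) (θu : ∀ n : ℕ, globalUnitsOf (F.layer n)), IsNormedEllipticUnitFamily F θu ∧
          ∀ d : GenusDatum F θu, ∃ Φ : PinnedKatoGenusFrame W K hK I d, IntegralComparisonShape Φ)
    (hE2 : ∀ (W : WeierstrassCurve ℚ) [W.IsElliptic] [W.IsGloballyMinimal] [Fact (Nat.Prime 7)], X12.ClassCSeven W →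
      ∃ (W' : WeierstrassCurve ℚ) (_ : W'.IsElliptic) (_ : W'.IsGloballyMinimal), WeierstrassCurve.IsIsogenous W W' ∧
        letI : ContinuousSMul ℤ_[7] (W'.tateModule 7) := TateModule.continuousSMul_padicInt
        ∀ (K : ZpExtension ℚ 7) (hK : K.IsCyclotomic) (γ : Field.absoluteGaloisGroup ℚ) (_ : K.IsTopGenerator γ)
          (I : IwasawaH1Data W' 7 K γ), Kato2004.HasMuFreeRealisedZetaFamily W' 7 K hK I) :
    ∀ (W : WeierstrassCurve ℚ) [W.IsElliptic] [W.IsGloballyMinimal] [Fact (Nat.Prime 7)], X12.ClassCSeven W →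
      ∃ (W' : WeierstrassCurve ℚ) (_ : W'.IsElliptic) (_ : W'.IsGloballyMinimal), WeierstrassCurve.IsIsogenous W W' ∧
        letI : ContinuousSMul ℤ_[7] (W'.tateModule 7) := TateModule.continuousSMul_padicInt
        (∃ (K : ZpExtension ℚ 7) (hK : K.IsCyclotomic) (γ : Field.absoluteGaloisGroup ℚ) (_ : K.IsTopGenerator γ)
          (I : IwasawaH1Data W' 7 K γ) (z₀ : I.H), Kato2004.IsAdmissibleZetaClass W' 7 K hK I z₀) ∧
        (∀ (K : ZpExtension ℚ 7) (hK : K.IsCyclotomic) (γ : Field.absoluteGaloisGroup ℚ) (_ : K.IsTopGenerator γ)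
          (I : IwasawaH1Data W' 7 K γ) (z₀ : I.H), Kato2004.IsAdmissibleZetaClass W' 7 K hK I z₀ →
          z₀ ∉ (IwasawaAlgebra.augIdealP 7 • (⊤ : Submodule (IwasawaAlgebra 7) I.H))) :=
  primitiveAdmissibleMemberSeven_of_unitGenus hstar hGZK h₄ h₂ h₂' hK1u
    (hK2c_of_k2cPinned hstar hGZK (k2cPinned_of_integralComparison hIC)) hE2

/-- **The RESIDUE closed form a v14 `genusResidueSeven_closed` seam states, from the UNIT-form K1ᵘ letter** (re-export of
`exists_genusResidueNonzero_of_unitK1u` under the skeleton-facing name). [cite: Tsuji1999, Thm. 3.1 (i) (p. 6)] [cite: Lang1990, Ch. 10 §2 Thm. 2.3 (PDF p. 172)] -/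
theorem genusResidueSeven_of_unitK1u
    (h₄ : Literature.NumberTheory.IwasawaTheory.tsuji1999_thm31_colemanMap)
    (h₂ : Literature.NumberTheory.IwasawaTheory.ferreroWashington_kubotaLeopoldtSeries_unitCoeff)
    (h₂' : Literature.NumberTheory.IwasawaTheory.ferreroWashington_stickelbergerSeries_unitCoeff)
    (hK1u : ∀ (F : GenusFrame) (θu : ∀ n : ℕ, globalUnitsOf (F.layer n)), IsNormedEllipticUnitFamily F θu →
      ∃ d : OrientedGenusDatum F θu, d.UnitFactorisationShape) :
    ∀ (F : GenusFrame) (θu : ∀ n : ℕ, globalUnitsOf (F.layer n)), IsNormedEllipticUnitFamily F θu →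
      ∃ d : GenusDatum F θu, GenusResidueNonzeroShape d :=
  exists_genusResidueNonzero_of_unitK1u h₄ h₂ h₂' hK1u

end Summit.BirchSwinnertonDyer.Rank1Residual.Additive.GenusSeven

end
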